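import Summits.AtomisticToContinuum.BoseEinsteinCondensation.Theses.BECInsertionCorrector
import Summits.AtomisticToContinuum.BoseEinsteinCondensation.Theorems.StaticResponseBound.Negative.Basic
import Summits.AtomisticToContinuum.BoseEinsteinCondensation.Theorems.BECInsertionCorrectorStaticResponseBoundSectorDecomposition
import Summits.AtomisticToContinuum.BoseEinsteinCondensation.Theorems.BECInsertionCorrectorStaticResponseBoundSectorCauchySchwarz
import Literature.MathematicalPhysics.QuantumManyBody.GroundStateDirichletForm
import Literature.MathematicalPhysics.QuantumManyBody.WeightedCorrector
import HarnessLib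

/-!
# The moment sandwich `m₋₁ ≤ m₁/ω²` — stub B1, part 1: pairing and Bessel for the weighted form

Helper file for the crux `BECInsertionCorrector.StaticResponseBound` (item
stmt-AtomisticToContinuum-12057), line `stable-fraction-square-completion`, registered stub **B1**
`stub_sectorFloorToHMinusOne` (brick B1 of the planner's `Lines/fsum-sector-sandwich.lean`): for a
periodic trial state `Θ` of total momentum `0` and a floor `0 < ω ≤ ω_Θ(p)` on the sectorial Poincaré
constant at `p = 2πk/L`, `‖∑ⱼ cos(p·xⱼ)‖²₋₁ ≤ N|p|²/(2ω²)` for the weight `|Θ|`.  This first part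
supplies the two ingredients that use the centre-of-mass (Bloch) sector components
`φ_q(X) = ĉ_q(s ↦ φ(X + s𝟙)) = L⁻³∫_{[0,L)³} e^{-2πiq·s/L} φ(X + s𝟙) ds` of a periodic function
(the `secdec_*` machinery of `Theorems/…SectorDecomposition{Fibre,Measure,}.lean`) against the
translation-invariant weight `|Θ|²` (`HasTotalMomentum 0 Θ.ψ`: `|Θ(X + s𝟙)|² = |Θ(X)|²`):

* **Bessel** (`b1_tsum_groundStateDirichletForm`, `b1_two_components_le`): the ground-state form is
  block-diagonal, `∑_q 𝓔_Θ(φ_q) = 𝓔_Θ(φ)` (fibrewise Parseval for the kinetic density,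
  `secdec_tsum_kineticDensity`, integrated against the diagonal-invariant weight,
  `secdec_lintegral_mul_fibre_average`), hence `𝓔_Θ(β_k) + 𝓔_Θ(β_{-k}) ≤ 𝓔_{|Θ|}(β, β)` for a real
  periodic test `β` and `k ≠ 0` (`groundStateDirichletForm_ofReal`);
* **the pairing bound** (`b1_pairing_eq`, `b1_pairing_bound`, the registered principal theorem of
  this part): averaging over the simultaneous shift (`secdec_setIntegral_fibre_average`), under which
  `ρ̂_k(X + s𝟙) = e_k(s)ρ̂_k(X)`, gives `∫ρ̂_k β|Θ|² = ∫ρ̂_k β_{-k}|Θ|²`; as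
  `∑ⱼ cos(2πk·xⱼ/L) = Re ρ̂_k`, Cauchy–Schwarz on the cell (`scs_norm_integral_mul_sq_le`) yields
  `(∫|Θ|² β ∑ⱼcos)² ≤ ‖ρ̂_k‖²_Θ ‖β_{-k}‖²_Θ`.

No new definitions.
-/

namespace Summit.AtomisticToContinuum.BoseEinsteinCondensation.Cruxes.StaticResponseBound.StableFractionSquareCompletion

open MeasureTheory Filter UnitAddTorus
open scoped ENNReal NNReal ComplexConjugate
open Literature.MathematicalPhysics.QuantumManyBody.BoseGas
open Summit.AtomisticToContinuum.BoseEinsteinCondensation.Theses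
open Summit.AtomisticToContinuum.BoseEinsteinCondensation.Theorems.StaticResponseBound.Negative

noncomputable section

variable {N : ℕ} {L : ℝ}

/-! ### Small bookkeeping lemmas -/

/-- `(2π/L) • q = latticeVec (2π/L) q`: the Bloch momentum of the sector components is the dual
lattice vector. [folklore] -/
theorem b1_smul_toLp_eq_latticeVec (c : ℝ) (q : Fin 3 → ℤ) :
    (c • (WithLp.toLp 2 fun t => (q t : ℝ) : EuclideanSpace ℝ (Fin 3))) = latticeVec c q := by
  ext t
  simp only [latticeVec, PiLp.smul_apply, PiLp.toLp_apply, smul_eq_mul]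

/-- `‖latticeVec c q‖² = c² ∑ᵢ qᵢ²`. [folklore] -/
theorem b1_norm_latticeVec_sq (c : ℝ) (q : Fin 3 → ℤ) :
    ‖latticeVec c q‖ ^ 2 = c ^ 2 * ∑ i, (q i : ℝ) ^ 2 := by
  rw [EuclideanSpace.real_norm_sq_eq, Finset.mul_sum]
  exact Finset.sum_congr rfl fun i _ => by simp only [latticeVec, PiLp.toLp_apply]; ring

/-- `conj e_{-n} = e_n` for the plane waves of the cell. [folklore] -/
theorem b1_conj_cellWave_neg (L : ℝ) (n : Fin 3 → ℤ) (x : Space) :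
    conj (cellWave L (-n) x) = cellWave L n x := by
  simp only [cellWave, mFourier_neg, Complex.conj_conj]

/-- The ground-state form sees the weight only through its modulus: `𝓔_{|Ψ|}(F) = 𝓔_Ψ(F)`.
[folklore] -/
theorem b1_groundStateDirichletForm_norm_weight (L : ℝ) (Ψ F : Config N → ℂ) :
    groundStateDirichletForm L (fun X => ((‖Ψ X‖ : ℝ) : ℂ)) F = groundStateDirichletForm L Ψ F := by
  unfold groundStateDirichletForm
  refine lintegral_congr fun X => ?_
  rw [Complex.nnnorm_real, nnnorm_norm]

/-- `‖F‖²_Ψ = ∫_{cell^N} ‖F‖² ‖Ψ‖²` as a real integral, for continuous data. [folklore] -/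
theorem b1_toReal_weightedNormSq (L : ℝ) {Ψ F : Config N → ℂ} (hΨ : Continuous Ψ)
    (hF : Continuous F) :
    (weightedNormSq L Ψ F).toReal = ∫ X in cellN N L, ‖F X‖ ^ 2 * ‖Ψ X‖ ^ 2 := by
  rw [weightedNormSq_eq, scs_toReal_lintegral_nnnorm_sq L (θ := fun X => F X * Ψ X) (hF.mul hΨ)]
  exact integral_congr_ae (Eventually.of_forall fun X => by simp only [norm_mul, mul_pow])

/-- **The sector components of a symmetric periodic `C¹` function are Bloch test functions** at the
dual lattice momentum `2πq/L`. [folklore] -/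
theorem b1_isBlochTest_component (hL : 0 < L) {φ : Config N → ℂ} (hφ : ContDiff ℝ 1 φ)
    (hper : IsTorusPeriodic L φ)
    (hsymm : ∀ (σ : Equiv.Perm (Fin N)) (X : Config N), φ (X ∘ σ) = φ X) (q : Fin 3 → ℤ) :
    IsBlochTest L (latticeVec (2 * Real.pi / L) q)
      (fun X => cellFourierCoeff L (fun s => φ (X + fun _ => s)) q) where
  contDiff := secdec_contDiff hL hφ hper q
  periodic X i a := secdec_isTorusPeriodic hper q X i a
  symm σ X := secdec_symm hsymm q σ X
  bloch := by
    rw [← b1_smul_toLp_eq_latticeVec]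
    exact secdec_hasTotalMomentum hL hper q

/-! ### Bessel: the ground-state form is block-diagonal in the sector components -/

/-- **Parseval for the ground-state form of a translation-invariant weight.**  For a periodic trial
state `Θ` of total momentum `0` and a periodic `C¹` function `φ`,
`∑_q 𝓔_Θ(φ_q) = 𝓔_Θ(φ)`, `φ_q(X) = ĉ_q(s ↦ φ(X + s𝟙))` (fibrewise Parseval for the kinetic density,
then the cell integral of a fibre average against the diagonal-invariant weight `|Θ|²`). [folklore] -/
theorem b1_tsum_groundStateDirichletForm (hL : 0 < L) (Θ : PeriodicTrialState N L)
    (hΘ : HasTotalMomentum 0 Θ.ψ) {φ : Config N → ℂ} (hφ : ContDiff ℝ 1 φ)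
    (hper : IsTorusPeriodic L φ) :
    ∑' q : Fin 3 → ℤ, groundStateDirichletForm L Θ.ψ
        (fun Y => cellFourierCoeff L (fun s => φ (Y + fun _ => s)) q) =
      groundStateDirichletForm L Θ.ψ φ := by
  -- the weight `W = |Θ|²` is measurable, periodic and diagonal-invariant
  set W : Config N → ℝ≥0∞ := fun X => (‖Θ.ψ X‖₊ : ℝ≥0∞) ^ 2 with hW
  have hWm : Measurable W :=
    Θ.contDiff.continuous.measurable.nnnorm.coe_nnreal_ennreal.pow_const 2
  have hWper : IsTorusPeriodic L W := fun X i a => by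
    simp only [hW, Θ.periodic X i a]
  have hWdiag : ∀ (X : Config N) (s : Space), W (X + fun _ => s) = W X := fun X s => by
    have h : Θ.ψ (X + fun _ => s) = Θ.ψ X := (hasTotalMomentum_zero_iff.1 hΘ) s X
    simp only [hW, h]
  -- the components and the kinetic density of `φ`
  have hkq : ∀ q, Measurable
      (kineticDensity fun Y => cellFourierCoeff L (fun s => φ (Y + fun _ => s)) q) :=
    fun q => measurable_kineticDensity (secdec_contDiff hL hφ hper q)
  have hkm : Measurable (kineticDensity φ) := measurable_kineticDensity hφ
  have hkper : IsTorusPeriodic L (kineticDensity φ) := fun X i a => by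
    have h : (fun Y => φ (Y + Pi.single i (EuclideanSpace.single a L))) = φ :=
      funext fun Y => hper Y i a
    conv_rhs => rw [← h]
    simp only [kineticDensity, fderiv_comp_add_right]
  obtain ⟨CD, hCD⟩ := secdec_exists_bound hL (hφ.continuous_fderiv one_ne_zero)
    (secdec_isTorusPeriodic_fderiv hper)
  unfold groundStateDirichletForm
  calc ∑' q, ∫⁻ X in cellN N L,
        kineticDensity (fun Y => cellFourierCoeff L (fun s => φ (Y + fun _ => s)) q) X * W X
      = ∫⁻ X in cellN N L, ∑' q,
          kineticDensity (fun Y => cellFourierCoeff L (fun s => φ (Y + fun _ => s)) q) X * W X :=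
        (lintegral_tsum fun q => ((hkq q).mul hWm).aemeasurable).symm
    _ = ∫⁻ X in cellN N L, W X * ((ENNReal.ofReal L ^ 3)⁻¹ *
          ∫⁻ s in cell L, kineticDensity φ (X + fun _ => s)) :=
        lintegral_congr fun X => by
          rw [ENNReal.tsum_mul_right, secdec_tsum_kineticDensity N L hL φ hφ hper X, mul_comm]
    _ = ∫⁻ X in cellN N L, W X * kineticDensity φ X :=
        secdec_lintegral_mul_fibre_average N L hL W hWper hWdiag _ hkm hkper _
          (ENNReal.sum_ne_top.2 fun i _ => ENNReal.sum_ne_top.2 fun a _ => ENNReal.ofReal_ne_top)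
          (secdec_kineticDensity_le hCD)
    _ = ∫⁻ X in cellN N L, kineticDensity φ X * W X := lintegral_congr fun X => mul_comm _ _

/-- **Bessel for the pair of sectors `±k`.**  For a periodic trial state `Θ` of total momentum `0`,
a real periodic test function `β` and `k ≠ 0`,
`𝓔_Θ(β_k) + 𝓔_Θ(β_{-k}) ≤ 𝓔_{|Θ|}(β, β)` (the two sectors are distinct terms of the Parseval sum,
and the ground-state form of the real data is the real Dirichlet form `dirichletFormW`). [folklore] -/
theorem b1_two_components_le (hL : 0 < L) (Θ : PeriodicTrialState N L)
    (hΘ : HasTotalMomentum 0 Θ.ψ) {β : Config N → ℝ} (hβ : IsPeriodicTest L β) {k : Fin 3 → ℤ}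
    (hk : k ≠ 0) :
    (groundStateDirichletForm L Θ.ψ (fun X =>
        cellFourierCoeff L (fun s => ((β (X + fun _ => s) : ℝ) : ℂ)) k)).toReal +
      (groundStateDirichletForm L Θ.ψ (fun X =>
        cellFourierCoeff L (fun s => ((β (X + fun _ => s) : ℝ) : ℂ)) (-k))).toReal ≤
      dirichletFormW L (fun X => ‖Θ.ψ X‖) β β := by
  have hφ : ContDiff ℝ 1 fun X => (β X : ℂ) := Complex.ofRealCLM.contDiff.comp hβ.contDiff
  have hφper : IsTorusPeriodic L fun X => (β X : ℂ) := fun X i a => by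
    simp only [hβ.periodic X i a]
  have hne : k ≠ -k := by
    intro h
    apply hk
    funext i
    have hi := congrFun h i
    simp only [Pi.neg_apply] at hi
    simp only [Pi.zero_apply]
    omega
  have hD0 : 0 ≤ dirichletFormW L (fun X => ‖Θ.ψ X‖) β β := dirichletFormW_self_nonneg _ _ _
  -- Parseval for the form, with the real Dirichlet form on the right
  have hsum := b1_tsum_groundStateDirichletForm hL Θ hΘ hφ hφper
  rw [← b1_groundStateDirichletForm_norm_weight L Θ.ψ (fun X => (β X : ℂ)),
    groundStateDirichletForm_ofReal Θ.contDiff.continuous.norm hβ.contDiff] at hsum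
  -- the two sectors `k ≠ -k` are two terms of the sum
  have h1 := ENNReal.sum_le_tsum (f := fun q => groundStateDirichletForm L Θ.ψ (fun X =>
    cellFourierCoeff L (fun s => ((β (X + fun _ => s) : ℝ) : ℂ)) q)) {k, -k}
  rw [Finset.sum_pair hne, hsum] at h1
  have hk_top := ne_top_of_le_ne_top ENNReal.ofReal_ne_top (le_self_add.trans h1)
  have hnk_top := ne_top_of_le_ne_top ENNReal.ofReal_ne_top (le_add_self.trans h1)
  have h2 := ENNReal.toReal_mono ENNReal.ofReal_ne_top h1
  rwa [ENNReal.toReal_add hk_top hnk_top, ENNReal.toReal_ofReal hD0] at h2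

/-! ### The pairing of `ρ̂_k` with a test function against the translation-invariant weight -/

/-- **The pairing identity.**  For a periodic trial state `Θ` of total momentum `0` and a continuous
periodic `φ`, `∫_{cell^N} ρ̂_k φ |Θ|² = ∫_{cell^N} ρ̂_k φ_{-k} |Θ|²`, `φ_{-k}(X) = ĉ_{-k}(s ↦ φ(X + s𝟙))`:
average the integrand over the simultaneous shift `X ↦ X + s𝟙` (`secdec_setIntegral_fibre_average`),
under which `|Θ|²` is invariant and `ρ̂_k` picks up the character `e_k(s) = conj e_{-k}(s)`.
[folklore] -/
theorem b1_pairing_eq (hL : 0 < L) (k : Fin 3 → ℤ) (Θ : PeriodicTrialState N L)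
    (hΘ : HasTotalMomentum 0 Θ.ψ) {φ : Config N → ℂ} (hφc : Continuous φ)
    (hper : IsTorusPeriodic L φ) :
    ∫ X in cellN N L, densityWave N L k X * (φ X * (((‖Θ.ψ X‖ ^ 2 : ℝ)) : ℂ)) =
      ∫ X in cellN N L, densityWave N L k X *
        (cellFourierCoeff L (fun s => φ (X + fun _ => s)) (-k) * (((‖Θ.ψ X‖ ^ 2 : ℝ)) : ℂ)) := by
  have hΘc : Continuous Θ.ψ := Θ.contDiff.continuous
  have hHc : Continuous fun Y => densityWave N L k Y * (φ Y * (((‖Θ.ψ Y‖ ^ 2 : ℝ)) : ℂ)) :=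
    (continuous_densityWave L k).mul (hφc.mul (Complex.continuous_ofReal.comp (hΘc.norm.pow 2)))
  have hHper : IsTorusPeriodic L fun Y => densityWave N L k Y * (φ Y * (((‖Θ.ψ Y‖ ^ 2 : ℝ)) : ℂ)) :=
    fun X i a => by
      simp only [secdec_densityWave_periodic hL.ne' k X i a, hper X i a, Θ.periodic X i a]
  obtain ⟨Cφ, hCφ⟩ := secdec_exists_bound hL hφc hper
  obtain ⟨CΘ, hCΘ⟩ := secdec_exists_bound hL hΘc Θ.periodic
  have hCφ0 : 0 ≤ Cφ := (norm_nonneg _).trans (hCφ 0)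
  have hHle : ∀ X, ‖densityWave N L k X * (φ X * (((‖Θ.ψ X‖ ^ 2 : ℝ)) : ℂ))‖ ≤
      N * (Cφ * CΘ ^ 2) := fun X => by
    rw [norm_mul, norm_mul, Complex.norm_real, Real.norm_of_nonneg (sq_nonneg _)]
    exact mul_le_mul (norm_densityWave_le L k X)
      (mul_le_mul (hCφ X) (pow_le_pow_left₀ (norm_nonneg _) (hCΘ X) 2) (sq_nonneg _) hCφ0)
      (by positivity) (Nat.cast_nonneg N)
  have hdiag : ∀ (X : Config N) (s : Space), Θ.ψ (X + fun _ => s) = Θ.ψ X := fun X s =>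
    (hasTotalMomentum_zero_iff.1 hΘ) s X
  -- the fibre average of the integrand is `ρ̂_k φ_{-k} |Θ|²`
  have hfib : ∀ X : Config N, (((L ^ 3)⁻¹ : ℝ) • ∫ s in cell L,
      densityWave N L k (X + fun _ => s) *
        (φ (X + fun _ => s) * (((‖Θ.ψ (X + fun _ => s)‖ ^ 2 : ℝ)) : ℂ))) =
      densityWave N L k X *
        (cellFourierCoeff L (fun s => φ (X + fun _ => s)) (-k) * (((‖Θ.ψ X‖ ^ 2 : ℝ)) : ℂ)) := by
    intro X
    have h1 : (fun s => densityWave N L k (X + fun _ => s) *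
        (φ (X + fun _ => s) * (((‖Θ.ψ (X + fun _ => s)‖ ^ 2 : ℝ)) : ℂ))) = fun s =>
        (densityWave N L k X * (((‖Θ.ψ X‖ ^ 2 : ℝ)) : ℂ)) *
          (conj (cellWave L (-k) s) * φ (X + fun _ => s)) := by
      funext s
      rw [secdec_densityWave_add_const, hdiag, b1_conj_cellWave_neg]
      ring
    rw [h1, integral_const_mul, ← mul_smul_comm, ← cellFourierCoeff_eq_integral hL]
    ring
  calc ∫ X in cellN N L, densityWave N L k X * (φ X * (((‖Θ.ψ X‖ ^ 2 : ℝ)) : ℂ))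
      = ∫ X in cellN N L, ((L ^ 3)⁻¹ : ℝ) • ∫ s in cell L,
          densityWave N L k (X + fun _ => s) *
            (φ (X + fun _ => s) * (((‖Θ.ψ (X + fun _ => s)‖ ^ 2 : ℝ)) : ℂ)) :=
        (secdec_setIntegral_fibre_average hL hHc hHper hHle).symm
    _ = _ := integral_congr_ae (Eventually.of_forall hfib)

/-- `Re ∫_{cell^N} ρ̂_k β |Θ|² = ∫_{cell^N} |Θ|² β ∑ⱼ cos(2πk·xⱼ/L)` for real continuous `β`
(the real part of `ρ̂_k` is the crux's observable). [folklore] -/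
theorem b1_re_pairing (L : ℝ) (k : Fin 3 → ℤ) (Θ : PeriodicTrialState N L) {β : Config N → ℝ}
    (hβc : Continuous β) :
    (∫ X in cellN N L, densityWave N L k X * ((β X : ℂ) * (((‖Θ.ψ X‖ ^ 2 : ℝ)) : ℂ))).re =
      ∫ X in cellN N L, ‖Θ.ψ X‖ ^ 2 *
        (β X * ∑ j, Real.cos (2 * Real.pi / L * ∑ i, (k i : ℝ) * X j i)) := by
  have hint : Integrable (fun X => densityWave N L k X * ((β X : ℂ) * (((‖Θ.ψ X‖ ^ 2 : ℝ)) : ℂ)))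
      (volume.restrict (cellN N L)) :=
    integrableOn_cellN ((continuous_densityWave L k).mul ((Complex.continuous_ofReal.comp hβc).mul
      (Complex.continuous_ofReal.comp (Θ.contDiff.continuous.norm.pow 2)))) L
  have h1 := integral_re hint
  simp only [RCLike.re_to_complex] at h1
  rw [← h1]
  refine integral_congr_ae (Eventually.of_forall fun X => ?_)
  have hre : ∀ j : Fin N,
      (Complex.exp (Complex.I * ↑(2 * Real.pi / L * ∑ i, (k i : ℝ) * X j i))).re =
        Real.cos (2 * Real.pi / L * ∑ i, (k i : ℝ) * X j i) := fun j => by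
    rw [Complex.exp_re]
    simp
  dsimp only
  rw [← Complex.ofReal_mul, Complex.mul_re, Complex.ofReal_re, Complex.ofReal_im, mul_zero,
    sub_zero, densityWave_eq_sum, Complex.re_sum]
  simp only [hre]
  ring

/-- **Cauchy–Schwarz for the pairing**: `(Re ∫ ρ̂_k G |Θ|²)² ≤ ‖ρ̂_k‖²_Θ ‖G‖²_Θ` for continuous `G`
(split `|Θ|² = |Θ|·|Θ|`). [folklore] -/
theorem b1_re_sq_le (L : ℝ) (k : Fin 3 → ℤ) (Θ : PeriodicTrialState N L) {G : Config N → ℂ}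
    (hG : Continuous G) :
    (∫ X in cellN N L, densityWave N L k X * (G X * (((‖Θ.ψ X‖ ^ 2 : ℝ)) : ℂ))).re ^ 2 ≤
      (∫ X in cellN N L, ‖densityWave N L k X‖ ^ 2 * ‖Θ.ψ X‖ ^ 2) *
        ∫ X in cellN N L, ‖G X‖ ^ 2 * ‖Θ.ψ X‖ ^ 2 := by
  have hΘn : Continuous fun X => ((‖Θ.ψ X‖ : ℝ) : ℂ) :=
    Complex.continuous_ofReal.comp Θ.contDiff.continuous.norm
  have hCS := scs_norm_integral_mul_sq_le L (fun X => densityWave N L k X * ((‖Θ.ψ X‖ : ℝ) : ℂ))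
    (fun X => G X * ((‖Θ.ψ X‖ : ℝ) : ℂ)) ((continuous_densityWave L k).mul hΘn) (hG.mul hΘn)
  have e1 : ∫ X in cellN N L, densityWave N L k X * ((‖Θ.ψ X‖ : ℝ) : ℂ) *
      (G X * ((‖Θ.ψ X‖ : ℝ) : ℂ)) =
      ∫ X in cellN N L, densityWave N L k X * (G X * (((‖Θ.ψ X‖ ^ 2 : ℝ)) : ℂ)) :=
    integral_congr_ae (Eventually.of_forall fun X => by push_cast; ring)
  have e2 : ∫ X in cellN N L, ‖densityWave N L k X * ((‖Θ.ψ X‖ : ℝ) : ℂ)‖ ^ 2 =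
      ∫ X in cellN N L, ‖densityWave N L k X‖ ^ 2 * ‖Θ.ψ X‖ ^ 2 :=
    integral_congr_ae (Eventually.of_forall fun X => by
      simp only [norm_mul, Complex.norm_real, norm_norm, mul_pow])
  have e3 : ∫ X in cellN N L, ‖G X * ((‖Θ.ψ X‖ : ℝ) : ℂ)‖ ^ 2 =
      ∫ X in cellN N L, ‖G X‖ ^ 2 * ‖Θ.ψ X‖ ^ 2 :=
    integral_congr_ae (Eventually.of_forall fun X => by
      simp only [norm_mul, Complex.norm_real, norm_norm, mul_pow])
  rw [e1, e2, e3] at hCS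
  refine le_trans ?_ hCS
  have hre := abs_le.1 (Complex.abs_re_le_norm
    (∫ X in cellN N L, densityWave N L k X * (G X * (((‖Θ.ψ X‖ ^ 2 : ℝ)) : ℂ))))
  exact sq_le_sq' hre.1 hre.2

/-! ### The registered principal theorem of this part -/

/-- **The pairing bound** (principal theorem of part 1 of stub B1): for a periodic trial state `Θ`
of total momentum `0` on the torus of side `L > 0` and a real periodic `C¹` test function `β`,
`(∫_{cell^N} |Θ|² β V_k)² ≤ ‖ρ̂_k‖²_Θ ‖β_{-k}‖²_Θ` with `V_k = ∑ⱼ cos(2πk·xⱼ/L) = Re ρ̂_k` and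
`β_{-k}(X) = ĉ_{-k}(s ↦ β(X + s𝟙))` the centre-of-mass Fourier component (only the component `β_{-k}`
pairs with `ρ̂_k` against a translation-invariant weight; then Cauchy–Schwarz). [folklore] -/
theorem b1_pairing_bound :
    ∀ (N : ℕ) (L : ℝ), 0 < L → ∀ (k : Fin 3 → ℤ) (Θ : PeriodicTrialState N L),
      HasTotalMomentum 0 Θ.ψ → ∀ (β : Config N → ℝ), IsPeriodicTest L β →
        (∫ X in cellN N L, ‖Θ.ψ X‖ ^ 2 *
            (β X * ∑ j, Real.cos (2 * Real.pi / L * ∑ i, (k i : ℝ) * X j i))) ^ 2 ≤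
          (∫ X in cellN N L, ‖densityWave N L k X‖ ^ 2 * ‖Θ.ψ X‖ ^ 2) *
            ∫ X in cellN N L,
              ‖cellFourierCoeff L (fun s => ((β (X + fun _ => s) : ℝ) : ℂ)) (-k)‖ ^ 2 *
                ‖Θ.ψ X‖ ^ 2 := by
  intro N L hL k Θ hΘ β hβ
  have hφ : ContDiff ℝ 1 fun X => (β X : ℂ) := Complex.ofRealCLM.contDiff.comp hβ.contDiff
  have hφper : IsTorusPeriodic L fun X => (β X : ℂ) := fun X i a => by
    simp only [hβ.periodic X i a]
  rw [← b1_re_pairing L k Θ hβ.continuous, b1_pairing_eq hL k Θ hΘ hφ.continuous hφper]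
  exact b1_re_sq_le L k Θ (secdec_contDiff hL hφ hφper (-k)).continuous

end

end Summit.AtomisticToContinuum.BoseEinsteinCondensation.Cruxes.StaticResponseBound.StableFractionSquareCompletion
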